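import Mathlib.LinearAlgebra.Span.Defs
import Mathlib.LinearAlgebra.Pi
import Mathlib.Data.ZMod.Basic
import Mathlib.Algebra.BigOperators.Pi
import Mathlib.Algebra.BigOperators.Ring.Finset
import Mathlib.Tactic.Abel
import Mathlib.Tactic.Ring
import HarnessLib

/-!
# Crux `Capture` (stmt-PneNP-2659), line `csp-spine-meet-to-join` rev 4 — two more `𝔽₂` facts for the
# span form of Theorem A (`span_prep_lemmas2`)

(4) a linear functional on `Fin nv → Fin l → ZMod 2` is the coefficient sum over the elementary vectors;
(5) the pseudo-evaluation functional `q ↦ q₀ + Σ q₁ i aᵢ + Σ q₂ (i,i') Y₂ (i,i')` of quadratic data kills the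
span of the four generator families of `QuadDivision` as soon as it kills each generator. Mathlib only;
consumed as hypotheses by `twoStep_unsat_iff_span`. Continuation lead c1, 2026-08-16. [folklore]
-/

namespace Summit.PneNP.PneNP.Cruxes.Capture.CspSpineMeetToJoin

set_option linter.dupNamespace false -- `Summit.PneNP.PneNP.…`: summit = sub-problem (D-0017)

/-- **Span preparation lemmas, part 2** (registered sub-goal `span_prep_lemmas2`). [folklore] -/
theorem span_prep_lemmas2 :
    (∀ (nv l : ℕ) (θ : (Fin nv → Fin l → ZMod 2) →ₗ[ZMod 2] ZMod 2) (ζ : Fin nv → Fin l → ZMod 2),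
      θ ζ = ∑ p : Fin nv × Fin l, θ (Pi.single p.1 (Pi.single p.2 1)) * ζ p.1 p.2) ∧
    (∀ (ι V : Type) [Fintype ι] [DecidableEq ι] [Fintype V] (e : V → ZMod 2 × (ι → ZMod 2))
      (a : ι → ZMod 2) (Y₂ : ι × ι → ZMod 2),
      (∀ v, (e v).1 + ∑ i, (e v).2 i * a i = 0) →
      (∀ v i, (e v).1 * a i + ∑ b, (e v).2 b * Y₂ (i, b) = 0) →
      (∀ i, a i + Y₂ (i, i) = 0) → (∀ i i', Y₂ (i, i') + Y₂ (i', i) = 0) →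
      ∀ q ∈ Submodule.span (ZMod 2)
        (Set.range (fun v : V => ((e v).1, (e v).2, (0 : ι × ι → ZMod 2))) ∪
         Set.range (fun vi : V × ι => ((0 : ZMod 2), Pi.single vi.2 (e vi.1).1,
            fun ab : ι × ι => if ab.1 = vi.2 then (e vi.1).2 ab.2 else 0)) ∪
         Set.range (fun i : ι => ((0 : ZMod 2), Pi.single i (1 : ZMod 2), Pi.single (i, i) (1 : ZMod 2))) ∪
         Set.range (fun ij : ι × ι => ((0 : ZMod 2), (0 : ι → ZMod 2),
            Pi.single ij (1 : ZMod 2) + Pi.single (ij.2, ij.1) (1 : ZMod 2)))),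
        q.1 + ∑ i, q.2.1 i * a i + ∑ i, ∑ i', q.2.2 (i, i') * Y₂ (i, i') = 0) := by
  refine ⟨fun nv l θ ζ => ?_, fun ι V _ _ _ e a Y₂ h1 h2 h3 h4 q hq => ?_⟩
  · -- expand `ζ` over the elementary vectors and use linearity
    have hζ : ζ = ∑ p : Fin nv × Fin l, ζ p.1 p.2 • (Pi.single p.1 (Pi.single p.2 (1 : ZMod 2)) :
        Fin nv → Fin l → ZMod 2) := by
      funext s t
      simp only [Finset.sum_apply, Pi.smul_apply, smul_eq_mul]
      rw [Fintype.sum_prod_type]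
      simp only [Pi.single_apply]
      rw [Finset.sum_eq_single s (fun b _ hb => by simp [Ne.symm hb]) (by simp)]
      simp only [if_true]
      rw [Finset.sum_eq_single t (fun b _ hb => by simp [Ne.symm hb]) (by simp)]
      simp
    conv_lhs => rw [hζ]
    rw [map_sum]
    exact Finset.sum_congr rfl fun p _ => by rw [map_smul, smul_eq_mul, mul_comm]
  · -- the pseudo-evaluation is a linear functional; it kills the generators, hence the span
    let PE : (ZMod 2 × (ι → ZMod 2) × (ι × ι → ZMod 2)) →ₗ[ZMod 2] ZMod 2 :=
      { toFun := fun q => q.1 + ∑ i, q.2.1 i * a i + ∑ p : ι × ι, q.2.2 p * Y₂ p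
        map_add' := fun p q => by
          simp only [Prod.fst_add, Prod.snd_add, Pi.add_apply, add_mul, Finset.sum_add_distrib]; abel
        map_smul' := fun t p => by
          simp only [Prod.smul_fst, Prod.smul_snd, Pi.smul_apply, smul_eq_mul, RingHom.id_apply,
            Finset.mul_sum, mul_add, mul_assoc] }
    have hgen : ∀ g ∈ (Set.range (fun v : V => ((e v).1, (e v).2, (0 : ι × ι → ZMod 2))) ∪
         Set.range (fun vi : V × ι => ((0 : ZMod 2), Pi.single vi.2 (e vi.1).1,
            fun ab : ι × ι => if ab.1 = vi.2 then (e vi.1).2 ab.2 else 0)) ∪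
         Set.range (fun i : ι => ((0 : ZMod 2), Pi.single i (1 : ZMod 2), Pi.single (i, i) (1 : ZMod 2))) ∪
         Set.range (fun ij : ι × ι => ((0 : ZMod 2), (0 : ι → ZMod 2),
            Pi.single ij (1 : ZMod 2) + Pi.single (ij.2, ij.1) (1 : ZMod 2)))), PE g = 0 := by
      rintro g (((⟨v, rfl⟩ | ⟨⟨v, i⟩, rfl⟩) | ⟨i, rfl⟩) | ⟨⟨i, i'⟩, rfl⟩)
      · simp only [PE, LinearMap.coe_mk, AddHom.coe_mk, Pi.zero_apply, zero_mul, Finset.sum_const_zero,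
          add_zero]
        exact h1 v
      · simp only [PE, LinearMap.coe_mk, AddHom.coe_mk, zero_add, Pi.single_apply, ite_mul, zero_mul,
          Finset.sum_ite_eq', Finset.mem_univ, if_true]
        rw [Fintype.sum_prod_type, Finset.sum_eq_single i (fun b _ hb => by simp [hb]) (by simp)]
        simpa using h2 v i
      · simp only [PE, LinearMap.coe_mk, AddHom.coe_mk, zero_add, Pi.single_apply, ite_mul, one_mul,
          zero_mul, Finset.sum_ite_eq', Finset.mem_univ, if_true]
        exact h3 i
      · simp only [PE, LinearMap.coe_mk, AddHom.coe_mk, zero_add, Pi.zero_apply, zero_mul,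
          Finset.sum_const_zero, Pi.add_apply, add_mul, Finset.sum_add_distrib, Pi.single_apply, ite_mul,
          one_mul, zero_mul, Finset.sum_ite_eq', Finset.mem_univ, if_true]
        exact h4 i i'
    have hle : Submodule.span (ZMod 2) _ ≤ LinearMap.ker PE := Submodule.span_le.2 fun g hg => hgen g hg
    have := hle hq
    simpa [PE, Fintype.sum_prod_type] using this

end Summit.PneNP.PneNP.Cruxes.Capture.CspSpineMeetToJoin
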